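import Literature.NumberTheory.Automorphic.RankinSelbergLocalUniqueness
import Literature.NumberTheory.Automorphic.RankinSelbergLocalGammaCounterexample
import HarnessLib

/-!
# The named fact `existsUnique_hasRSEpsilon` of `RankinSelbergLocal` is false as elaborated

`Literature/NumberTheory/Automorphic/RankinSelbergLocal.lean` records Jacquet–Piatetski-Shapiro–
Shalika's existence and uniqueness of the local `ε`-factor `ε(s, π × π', ψ) = e · q^{-as}` of a
pair of irreducible admissible generic representations of `GL_n(F) × GL_m(F)`, `m < n`
(1983, Thm. 2.7 (iii); Cogdell, *Analytic theory of `L`-functions for `GL_n`*, §3.1, Thm. 3.2 and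
the paragraph after it: "`ε(s, π × π', ψ)` is a monomial function of the form `c q^{-fs}`";
Getz–Hahn 2024, (11.15) and Prop. 11.5.5) as the named fact
`existsUnique_hasRSEpsilon hmn π π' ψ ν μ : Prop` (`∃! (e, a), HasRSEpsilon hmn π π' ψ μ ν e a`).
Its docstring and the module's design notes take `ν` to be THE `GL_m(F)`-invariant measure on
`GL_m(F) ⧸ U_m` and `μ` an additive Haar measure on `F`, and the file declares
`[BorelSpace (GL_m ⧸ U_m)]`, `[SMulInvariantMeasure GL_m (GL_m ⧸ U_m) ν]`,
`[IsFiniteMeasureOnCompacts ν]`, `[ν.IsOpenPosMeasure]`, `[BorelSpace F]`, `[μ.IsAddHaarMeasure]`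
as section instances (its lines 708–723) — but a `def … : Prop` abstracts only the section
variables its body uses, so NONE of the six is an argument of the fact:
`#check @existsUnique_hasRSEpsilon` ends
`… [MeasurableSpace (GL (Fin m) F ⧸ _)] → Measure (GL (Fin m) F ⧸ _) → [MeasurableSpace F] →
Measure F → Prop` (checked 2026-08-15; the same loss for the sibling facts is recorded in
`RankinSelbergLocalUniqueness`, `RankinSelbergLocalGammaCounterexample`,
`RankinSelbergLocalLFactorCounterexample`, `RankinSelbergLocalEpsilonZeroMeasure`). As elaborated
the fact quantifies over ARBITRARY measures `ν`, `μ` and is false: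

* `not_existsUnique_hasRSEpsilon_zero_measure`, `…_of_hyp`: at `ν = 0` every zeta integral
  `∫ … ∂0` vanishes, so no polynomial satisfies clause (b) of `HasRSLFactor`
  (`not_hasRSLFactor_zero_measure`), there are no `ε`-data at all
  (`not_hasRSEpsilon_zero_measure` of `RankinSelbergLocalUniqueness`), and `∃! (e, a)` fails for
  lack of existence — for every `μ` and all data meeting the hypotheses on `π, π', ψ`.
* `not_existsUnique_hasRSEpsilon`: a CLOSED counterexample to the universally quantified fact,
  with the data of `not_forall_existsUnique_hasRSGamma` (`RankinSelbergLocalGammaCounterexample`):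
  `F = ℚ_v` for a finite place `v` of `ℚ` at which the local component `ψ_v` of Tate's character
  is non-trivial (`eventually_exists_adeleAddCharAt_ne_one`, `continuous_adeleAddCharAt` of
  `AdelicAdditiveCharacterDuality`; `ℚ_v` is a non-archimedean local field by
  `AdicCompletionLocalField`), `n = 1`, `m = 0`, `π`, `π'` the trivial representations of
  `GL_1(ℚ_v)`, `GL_0(ℚ_v)` on `ℂ` (irreducible, admissible, generic: `isIrreducible_trivial_complex`,
  `isAdmissible_trivial_complex`, `isGeneric_trivial_of_le_one`), `ν = 0`, `μ = 0`.

So no closed proof `existsUnique_hasRSEpsilon_holds : existsUnique_hasRSEpsilon …` can exist. The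
second failure mode, at `μ = 0` with `1 ≤ m`, `2 ≤ n - m` (the tilde integrals `Ψ_{n-m-1}`
vanish, `γ = 0`, `e = 0`, and `a` is not unique), is `not_existsUnique_hasRSEpsilon_measure_zero`
of `RankinSelbergLocalEpsilonZeroMeasure`. The INTENDED statement — Jacquet–Piatetski-Shapiro–
Shalika 1983, Thm. 2.7 with `dh` the invariant measure on `N_m \ GL_m` and `dx` Haar — re-binds
the six instances inside the def, exactly as `hasRSEpsilon_ne_zero_haar`
(`RankinSelbergLocalCorrected`) does for `hasRSEpsilon_ne_zero`:

  `def existsUnique_hasRSEpsilon_haar (hmn : m < n) (π …) (π' …) (ψ : AddChar F Circle)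
    [MeasurableSpace (GL (Fin m) F ⧸ U_m)] [BorelSpace (GL (Fin m) F ⧸ U_m)] (ν : Measure _)
    [SMulInvariantMeasure (GL (Fin m) F) (GL (Fin m) F ⧸ U_m) ν] [IsFiniteMeasureOnCompacts ν]
    [ν.IsOpenPosMeasure] [MeasurableSpace F] [BorelSpace F] (μ : Measure F) [μ.IsAddHaarMeasure] :
    Prop := ∀ [π.IsIrreducible] [π'.IsIrreducible], π.IsAdmissible → π'.IsAdmissible →
      IsGeneric π ψ → IsGeneric π' ψ⁻¹ → ψ.IsContinuousNontrivial →
      ∃! ea : ℂ × ℤ, HasRSEpsilon hmn π π' ψ μ ν ea.1 ea.2`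

(left to a restatement seat; not introduced here — this file has theorems only, D-0026). At such
measures the uniqueness half is proved for every `ν`, `μ` (`HasRSEpsilon.existsUnique_of_exists`,
`RankinSelbergLocalUniqueness`) and the degenerate case `m = 0` holds outright
(`existsUnique_hasRSEpsilon_rank_zero`, `RankinSelbergLocalRankZero`: `L = L̃ = 1`, `γ = ε = 1`).

## References

* H. Jacquet, I. I. Piatetski-Shapiro, J. A. Shalika, *Rankin–Selberg convolutions*, Amer. J.
  Math. 105 (1983), 367–464, doi:10.2307/2374264, §2, Thm. 2.7 (held as a scan without text
  layer; numbering as recorded in `RankinSelbergLocal`). [JacquetPiatetskiShapiroShalika1983]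
* J. W. Cogdell, *Analytic theory of `L`-functions for `GL_n`*, in J. Bernstein, S. Gelbart
  (eds.), *An Introduction to the Langlands Program*, Birkhäuser, §3.1: the integrals `Ψ_j` over
  `N_m(k) \ GL_m(k)` and `M_{j,m}(k)`, Thm. 3.1 (`L`), Thm. 3.2 (functional equation with
  `ω'(-1)^{n-1} γ`), `ε = γ L(s, π × π') / L(1 - s, π̃ × π̃')` a monomial `c q^{-fs}` (read).
  [CogdellAnalyticTheory2004]
* J. R. Getz, H. Hahn, *An Introduction to Automorphic Representations*, GTM 300 (2024), §11.5,
  (11.12), Prop. 11.5.1, Thm. 11.5.4, (11.15), Prop. 11.5.5 (read). [GetzHahn2024]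
-/

set_option autoImplicit false

open MeasureTheory NumberField IsDedekindDomain

noncomputable section

namespace Literature.NumberTheory.Automorphic

/-! ### The fact at the zero measure on `GL_m ⧸ U_m` -/

section ZeroMeasure

variable {F : Type*} [Field F] [ValuativeRel F] [TopologicalSpace F] [IsNonarchimedeanLocalField F]
  {n m : ℕ} {V : Type*} [AddCommGroup V] [Module ℂ V] {V' : Type*} [AddCommGroup V'] [Module ℂ V']
  [MeasurableSpace (GL (Fin m) F ⧸ upperUnitriangular (Fin m) F)]
  {hmn : m < n} {π : Representation ℂ (GL (Fin n) F) V} {π' : Representation ℂ (GL (Fin m) F) V'}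
  {ψ : AddChar F Circle} [MeasurableSpace F] {μ : Measure F}

/-- **At `ν = 0` there are no `ε`-data, hence no unique `ε`-data.** Every zeta integral against
the zero measure on `GL_m ⧸ U_m` vanishes, so clause (b) of `HasRSLFactor` (`1/P(q^{-s})` is a
combination of zeta integrals) fails for every `P` and `HasRSEpsilon hmn π π' ψ μ 0 e a` never
holds (`not_hasRSEpsilon_zero_measure`); in particular `∃! (e, a)` fails for lack of existence,
for every additive measure `μ`. [folklore] -/
theorem not_existsUnique_hasRSEpsilon_zero_measure :
    ¬ ∃! ea : ℂ × ℤ, HasRSEpsilon hmn π π' ψ μ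
        (0 : Measure (GL (Fin m) F ⧸ upperUnitriangular (Fin m) F)) ea.1 ea.2 :=
  fun ⟨_, hea, _⟩ => not_hasRSEpsilon_zero_measure hea

/-- **The named fact `existsUnique_hasRSEpsilon` fails at `ν = 0`** (any `μ`) for all data
meeting its hypotheses (`π`, `π'` irreducible admissible generic, `ψ` non-trivial continuous).
The measure `ν = 0` is admitted by the fact because its invariance / Radon hypotheses were
section instances not captured by the `def`. [folklore] -/
theorem not_existsUnique_hasRSEpsilon_zero_measure_of_hyp [π.IsIrreducible] [π'.IsIrreducible]
    (hπ : π.IsAdmissible) (hπ' : π'.IsAdmissible) (hg : IsGeneric π ψ) (hg' : IsGeneric π' ψ⁻¹)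
    (hψ : ψ.IsContinuousNontrivial) :
    ¬ existsUnique_hasRSEpsilon hmn π π' ψ
        (0 : Measure (GL (Fin m) F ⧸ upperUnitriangular (Fin m) F)) μ :=
  fun h => not_existsUnique_hasRSEpsilon_zero_measure (h hπ hπ' hg hg' hψ)

end ZeroMeasure

/-! ### A closed counterexample over `ℚ_v` -/

section Counterexample

/-- **The named fact `existsUnique_hasRSEpsilon` of `RankinSelbergLocal`, universally closed, is
FALSE.** Counterexample: `F = ℚ_v` for a finite place `v` of `ℚ` at which the local component
`ψ_v` of Tate's character is non-trivial (all but finitely many `v`,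
`eventually_exists_adeleAddCharAt_ne_one`; continuity: `continuous_adeleAddCharAt`), `n = 1`,
`m = 0`, `π`, `π'` the trivial representations of `GL_1(ℚ_v)`, `GL_0(ℚ_v)` on `ℂ` (irreducible,
admissible, generic since `U_1 = U_0 = 1`), and the ZERO measures `ν = 0` on `GL_0 ⧸ U_0`,
`μ = 0` on `F`, which the fact admits because its six measure instances were section variables
not captured by the `def`: then no `(e, a)` satisfies `HasRSEpsilon`
(`not_existsUnique_hasRSEpsilon_zero_measure_of_hyp`), contradicting `∃!`. With the intended
hypotheses (`0 < ν(pt) < ∞`) this very instance holds with `(e, a) = (1, 0)`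
(`existsUnique_hasRSEpsilon_rank_zero`, `RankinSelbergLocalRankZero`). The intended statement is
Jacquet–Piatetski-Shapiro–Shalika 1983, Thm. 2.7 (iii) with `ν` THE invariant measure and `μ`
additive Haar (the six instances re-bound inside the def, see the module docstring). [folklore] -/
theorem not_existsUnique_hasRSEpsilon :
    ¬ ∀ (F : Type) [Field F] [ValuativeRel F] [TopologicalSpace F] [IsNonarchimedeanLocalField F]
        (n m : ℕ) (V : Type) [AddCommGroup V] [Module ℂ V] (V' : Type) [AddCommGroup V']
        [Module ℂ V'] (hmn : m < n) (π : Representation ℂ (GL (Fin n) F) V)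
        (π' : Representation ℂ (GL (Fin m) F) V') (ψ : AddChar F Circle)
        [MeasurableSpace (GL (Fin m) F ⧸ upperUnitriangular (Fin m) F)]
        (ν : Measure (GL (Fin m) F ⧸ upperUnitriangular (Fin m) F)) [MeasurableSpace F]
        (μ : Measure F), existsUnique_hasRSEpsilon hmn π π' ψ ν μ := by
  intro h
  haveI := infinite_heightOneSpectrum' ℚ
  obtain ⟨v, u, -, hu⟩ := (eventually_exists_adeleAddCharAt_ne_one ℚ).exists
  letI : MeasurableSpace (v.adicCompletion ℚ) := ⊤
  letI : MeasurableSpace (GL (Fin 0) (v.adicCompletion ℚ) ⧸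
      upperUnitriangular (Fin 0) (v.adicCompletion ℚ)) := ⊤
  haveI := isIrreducible_trivial_complex (GL (Fin 1) (v.adicCompletion ℚ))
  haveI := isIrreducible_trivial_complex (GL (Fin 0) (v.adicCompletion ℚ))
  have hψ : (adeleAddCharAt ℚ v).IsContinuousNontrivial :=
    ⟨continuous_adeleAddCharAt ℚ v, fun h0 => hu (by rw [h0, AddChar.zero_apply])⟩
  exact not_existsUnique_hasRSEpsilon_zero_measure_of_hyp (μ := (0 : Measure (v.adicCompletion ℚ)))
    (isAdmissible_trivial_complex _) (isAdmissible_trivial_complex _)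
    (isGeneric_trivial_of_le_one le_rfl _) (isGeneric_trivial_of_le_one (Nat.zero_le 1) _) hψ
    (h (v.adicCompletion ℚ) 1 0 ℂ ℂ Nat.zero_lt_one (Representation.trivial ℂ _ ℂ)
      (Representation.trivial ℂ _ ℂ) (adeleAddCharAt ℚ v) 0 0)

end Counterexample

end Literature.NumberTheory.Automorphic
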